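import Summits.BirchSwinnertonDyer.BirchSwinnertonDyer.Theorems.SchneiderFreeAdditiveX3AnomalousTwistRationalLine
import Summits.BirchSwinnertonDyer.BirchSwinnertonDyer.Theorems.SchneiderFreeAdditiveX3AnomalousTwistLocalHZero
import Summits.BirchSwinnertonDyer.BirchSwinnertonDyer.Theorems.EisensteinPrimesCharLocalLemmas
import HarnessLib

/-!
# Route `SchneiderFreeAdditiveX3` (K1 door), crux r3 `GordTwoBranchIMC` (stmt-BirchSwinnertonDyer-19177): THE ORIENTATION AND THE
# `K`-TORSION BINDER OF THE ANOMALOUS-TWIN λ-INEQUALITY ARE AUTOMATIC under Keller–Yin's lattice normalisation — `θsub|_{D_v̄} ≠ 𝟙`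
# (indeed `θsub` ramified at `v̄`) for EVERY residual pair of `W_K[3]`, and `W(K)[3] = 0`

Cell `bsd-schneider-ideate`, seat `bsd-schneider-door-c5` (prover, generation 31; assembly layer; `--supports` 19177, helper).
PARTITION: board row B6 ∩ X3 ∩ sst-twist, `r = 1` — the 1 725 ANOMALOUS pairs of the (G-ord, `e = 2`) half at `p = 3` (of 2 411).
bears_on: K1-door (items 18971/18972 retired → 19177 r3).  FILE 8b of the port of cell `bsd-eis`'s V21 INDEX ROAD to the door's ANOMALOUS TWIN
`W = C • V^{(−3)}` (FINDING-door-c5-g28 §5b `stub_λW`): the two displayed binders of FILES 3–7 — the orientation `hram : ∃ τ ∈ D_v̄,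
unitChar θsub τ ≠ 1` and `htor : W(K)[3] = 0` — DISCHARGED from `hnorm : ∀ Ψ, IsRationalLine W 3 Ψ → ¬ LineDecompositionTrivialAt W 3 Ψ`:
* §3 `false_of_forall_decomp_smul_sub_eq` — a `Γ_K`-stable line of `W_K[3]` fixed pointwise by `D_v̄` pulls back along
  `t : W[3](ℚ̄) ≅ W_K[3](K̄)` to a `res(Γ_K)`-stable, hence RATIONAL (FILE 8a), line whose open pointwise stabiliser contains `res(D_v̄)`, hence
  `D_𝔔` (CHL's degree-one lemma `decompositionSubgroup_le_of_decomp_le`) — a rational `D`-trivial line, against `hnorm`;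
  `exists_mem_inertia_unitChar_ne_one_of_anomalousTwist_of_normalised` — for EVERY residual pair `(θsub, θquot)` of `W_K[3]` some `τ ∈ I_v̄`
  has `unitChar θsub τ ≠ 1` (FILE 2's dichotomy; the other branch is §3's contradiction); `…decomp…` the `D_v̄`-form `hram`;
* §4 `forall_baseChange_nsmul_eq_zero_of_anomalousTwist_of_normalised` — `W(K)[3] = 0`: a `K`-rational `3`-torsion point spans a
  `Γ_K`-fixed line (Keller–Yin's standing `H⁰(K, ρ̄) = 0`; the door analogue of generation 28's `GoodLatticeNoKTorsion` and x2's
  `SplitMultLatticeBinders`).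

HONEST FRAMING: unconditional helper theorems (no definition, no named fact, no `sorry`); nothing analytic; no registered stub closed; no item
closed; BSD proved for no curve; «closes rung: none».  References: Keller–Yin arXiv:2410.23241 §3.3 and arXiv:2402.12781v2 §1.3–§1.4
[KellerYin2024]; Serre 1972 §1.11 [Serre1972]; Neukirch ANT I §9 [NeukirchANT1999]; x1 `AnomalousLocalMover`, x2 `SplitMultLatticeBinders`.
-/

set_option autoImplicit false
-- the route's Theorems namespace repeats the summit name by design (D-0017 nested layout)
set_option linter.dupNamespace false

noncomputable section

open scoped Classical Pointwise

namespace Summit.BirchSwinnertonDyer.BirchSwinnertonDyer.Theorems.SchneiderFreeAdditiveX3.AnomalousTwistOrientation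

open NumberField IsDedekindDomain Field WeierstrassCurve Rat.HeightOneSpectrum
  Literature.NumberTheory.EllipticCurves Literature.NumberTheory.EllipticCurves.GreenbergSelmer
  Literature.NumberTheory.EllipticCurves.Rank1Residual Literature.NumberTheory.GaloisRepresentations
  Literature.NumberTheory.EllipticCurves.KellerYin2024
  Summit.BirchSwinnertonDyer.Rank1Residual Summit.BirchSwinnertonDyer.Rank1Residual.GaloisImage
  Summit.BirchSwinnertonDyer.Rank1Residual.X2.ResidualDevissageModules
  Summit.BirchSwinnertonDyer.BirchSwinnertonDyer.Theorems.ResidualLineRigidity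
  Summit.BirchSwinnertonDyer.BirchSwinnertonDyer.Theorems.SchneiderFreeAdditiveX3.SemistableTwistLocal
  Summit.BirchSwinnertonDyer.BirchSwinnertonDyer.Theorems.SchneiderFreeAdditiveX3.AnomalousTwistLocalLines
  Summit.BirchSwinnertonDyer.BirchSwinnertonDyer.Theorems.SchneiderFreeAdditiveX3.AnomalousTwistLocalData
  Summit.BirchSwinnertonDyer.BirchSwinnertonDyer.Theorems.CumulativeHeegnerInclusionAtThreeLineBaseChange
  Summit.BirchSwinnertonDyer.BirchSwinnertonDyer.Theorems.SchneiderFreeAdditiveX3.AnomalousTwistRationalLine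

section Quadratic

variable {V W : WeierstrassCurve ℚ} [V.IsElliptic] [V.IsGloballyMinimal] [W.IsElliptic] {p : ℕ} [hp : Fact p.Prime]
  {K : Type} [Field K] [NumberField K]

/-! ## §3. The orientation: `θsub` is non-trivial on `D_v̄` for EVERY residual pair -/

/-- **A `Γ_K`-stable line of `W_K[3]` fixed pointwise by `D_v̄` pulls back to a RATIONAL `D₃`-TRIVIAL line of `W[3](ℚ̄)`** — impossible
under the normalisation.  (`t : W[3](ℚ̄) ≅ W_K[3](K̄)` equivariant; `t⁻¹(S)` is `res(Γ_K)`-stable, hence rational by §2; the pointwise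
stabiliser of `t⁻¹(S)` is open and contains `res(D_v̄)`, so CHL's degree-one lemma `decompositionSubgroup_le_of_decomp_le` puts `D_𝔔` inside
it for the contraction `𝔔` of `𝔓_{v̄}`; §1.) [cite: KellerYin2024, arXiv:2410.23241 §3.3; arXiv:2402.12781v2 §1.3 Prop. 1.3.1] [cite: NeukirchANT1999, Ch. I §9 (9.4)–(9.6)] -/
theorem false_of_forall_decomp_smul_sub_eq (hp3 : p = 3) (hV : GoodOrd V p) (ha : (p : ℤ) ∣ V.frobeniusTrace p - 1)
    (C : VariableChange ℚ) (hC : C • V.quadraticTwist ((-1 : ℚ) ^ (p / 2) * p) = W)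
    (hnorm : ∀ Ψ : AddSubgroup (geomTorsion W (p : ℤ)), IsRationalLine W p Ψ → ¬ LineDecompositionTrivialAt W p Ψ)
    (hred : Red W p) (hK : IsImaginaryQuadratic K) {v vbar : HeightOneSpectrum (𝓞 K)} (hpvK : ((p : ℕ) : 𝓞 K) ∈ v.asIdeal)
    (hvbar : ((p : ℕ) : 𝓞 K) ∈ vbar.asIdeal) (hne : vbar ≠ v)
    (S : StableSubgroup (absoluteGaloisGroup K) ((W.baseChange K).geomTorsion ((p : ℕ) : ℤ))) (hSub : Nat.card S.Sub = p)
    (hfixD : ∀ g ∈ decomp vbar, ∀ x : S.Sub, g • x = x) : False := by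
  have hpp : p.Prime := hp.out
  haveI hEK : (W.baseChange K).IsElliptic := inferInstanceAs (W.map (algebraMap ℚ K)).IsElliptic
  haveI : Algebra.IsQuadraticExtension ℚ K := ⟨hK.1⟩
  obtain ⟨⟨he, hf⟩, -⟩ := LocalField.ramificationIdx_eq_one_and_inertiaDeg_eq_one_of_ne p vbar v hne hvbar hpvK
  set u : HeightOneSpectrum (𝓞 ℚ) := vbar.under (𝓞 ℚ) with hu
  have hw : vbar.asIdeal.under (𝓞 ℚ) = u.asIdeal := by rw [hu, HeightOneSpectrum.under_asIdeal]
  have hpv : ((p : ℕ) : 𝓞 ℚ) ∈ u.asIdeal := AnomalousLocalTorsion.natCast_mem_under_rat (K := K) hvbar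
  -- the line `Ψ = t⁻¹(S)` over `ℚ̄`
  obtain ⟨t, ht⟩ := exists_geomTorsion_baseChange_equiv W K ((p : ℕ) : ℤ)
  have ht' : ∀ (σ : absoluteGaloisGroup K) (P : W.geomTorsion ((p : ℕ) : ℤ)),
      t (absGaloisRestrict ℚ K σ • P) = σ • t P := fun σ P ↦ by
    rw [← resGal_eq_absGaloisRestrict]; exact ht σ P
  let Ψ : AddSubgroup (W.geomTorsion ((p : ℕ) : ℤ)) := S.toAddSubgroup.comap t.toAddMonoidHom
  have hΨmem : ∀ P : W.geomTorsion ((p : ℕ) : ℤ), P ∈ Ψ ↔ t P ∈ S.toAddSubgroup := fun _ ↦ Iff.rfl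
  have hΨcard : Nat.card Ψ = p := by
    have e : Ψ ≃ S.toAddSubgroup :=
      { toFun := fun x ↦ ⟨t x.1, x.2⟩
        invFun := fun y ↦ ⟨t.symm y.1, by
          change t (t.symm y.1) ∈ S.toAddSubgroup
          rw [t.apply_symm_apply]; exact y.2⟩
        left_inv := fun x ↦ Subtype.ext (t.symm_apply_apply x.1)
        right_inv := fun y ↦ Subtype.ext (t.apply_symm_apply y.1) }
    have h : Nat.card Ψ = Nat.card S.Sub := Nat.card_congr e
    exact h.trans hSub
  have hresst : ∀ (γ : absoluteGaloisGroup K), ∀ P ∈ Ψ, absGaloisRestrict ℚ K γ • P ∈ Ψ := fun γ P hP ↦ by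
    rw [hΨmem, ht']
    exact S.smul_mem' γ ((hΨmem P).mp hP)
  -- `Ψ` is rational (§2)
  have hrat : IsRationalLine W p Ψ :=
    isRationalLine_of_forall_restrict_smul_mem_of_anomalousTwist hp3 hV ha C hC hnorm hred hK hΨcard hresst
  -- `res(D_v̄)` fixes `Ψ` pointwise
  have hfixres : ∀ γ ∈ decomp vbar, ∀ P ∈ Ψ, absGaloisRestrict ℚ K γ • P = P := by
    intro γ hγ P hP
    have hPS : t P ∈ S.toAddSubgroup := (hΨmem P).mp hP
    obtain ⟨x, hx⟩ : ∃ x : S.Sub, S.incl x = t P := by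
      have : t P ∈ S.incl.range := by rw [S.range_incl]; exact hPS
      exact this
    apply t.injective
    rw [ht', ← hx, ← StableSubgroup.incl_smul, hfixD γ hγ x]
  -- the pointwise stabiliser of `Ψ`, an open subgroup of `Γ_ℚ` containing `res(D_v̄)`, hence `D_𝔔`
  let T : Subgroup (absoluteGaloisGroup ℚ) :=
    { carrier := {g | ∀ P ∈ Ψ, g • P = P}
      mul_mem' := fun {a b} ha hb P hP ↦ by
        rw [mul_smul, hb P hP, ha P hP]
      one_mem' := fun P _ ↦ one_smul _ P
      inv_mem' := fun {a} ha P hP ↦ by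
        conv_lhs => rw [← ha P hP]
        rw [inv_smul_smul] }
  have hTmem : ∀ g : absoluteGaloisGroup ℚ, g ∈ T ↔ ∀ P ∈ Ψ, g • P = P := fun _ ↦ Iff.rfl
  have hTopen : IsOpen (T : Set (absoluteGaloisGroup ℚ)) := by
    refine Subgroup.isOpen_mono ?_ (isOpen_iInf_stabilizer_geomTorsion W p)
    intro g hg
    rw [hTmem]
    intro P _
    have h := (Subgroup.mem_iInf.mp hg) P
    exact Subtype.ext (by rw [AddSubgroup.torsionBy.coe_smul]; exact h)
  have hle : ∀ γ ∈ decomp vbar, absGaloisRestrict ℚ K γ ∈ T := fun γ hγ ↦ (hTmem _).mpr (hfixres γ hγ)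
  set 𝔔 := adicCompletionPrime K vbar with h𝔔def
  have h𝔔 : 𝔔 ∈ vbar.primesAbove := adicCompletionPrime_mem_primesAbove K vbar
  set 𝔓 := 𝔔.comap (absIntegersMap ℚ K) with h𝔓def
  have h𝔓 : 𝔓 ∈ u.primesAbove := comap_absIntegersMap_mem_primesAbove hw h𝔔
  have hDT : 𝔓.decompositionSubgroup (absoluteGaloisGroup ℚ) ≤ T :=
    decompositionSubgroup_le_of_decomp_le K hw he hf T hTopen hle
  -- `Ψ` is `D`-trivial: contradiction with the normalisation
  exact hnorm Ψ hrat (lineDecompositionTrivialAt_of_forall_smul_eq hrat hpv h𝔓 fun g hg ↦ (hTmem g).mp (hDT hg))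

/-- **THE ORIENTATION IS AUTOMATIC: for EVERY residual pair `(θsub, θquot)` of `W_K[3]` some inertia element `τ ∈ I_v̄` has
`unitChar θsub τ ≠ 1`** — `W` the anomalous `(−3)`-twist under the normalisation «every rational `3`-line is `D₃`-non-trivial», `K` imaginary
quadratic with `3 = v v̄`.  FILE 2's dichotomy at the pair's stable line: the branch «`D_v̄` fixes the line» is §3's contradiction; the other branch
gives an inertia mover, which cannot act trivially on `(F/𝒪)(θsub) ⊇ j₁(Φ)`.  This discharges the binder `hram` of FILES 3–7 (and x2's `hramI`).
[cite: KellerYin2024, arXiv:2410.23241 §3.3; arXiv:2402.12781v2 Prop. 1.3.1, §1.4 display (char to f)] [cite: Serre1972, §1.11 Prop. 12] -/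
theorem exists_mem_inertia_unitChar_ne_one_of_anomalousTwist_of_normalised (hp3 : p = 3) (hV : GoodOrd V p)
    (ha : (p : ℤ) ∣ V.frobeniusTrace p - 1)
    (C : VariableChange ℚ) (hC : C • V.quadraticTwist ((-1 : ℚ) ^ (p / 2) * p) = W)
    (hnorm : ∀ Ψ : AddSubgroup (geomTorsion W (p : ℤ)), IsRationalLine W p Ψ → ¬ LineDecompositionTrivialAt W p Ψ)
    (hred : Red W p) (hK : IsImaginaryQuadratic K) {v vbar : HeightOneSpectrum (𝓞 K)} (hpvK : ((p : ℕ) : 𝓞 K) ∈ v.asIdeal)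
    (hvbar : ((p : ℕ) : 𝓞 K) ∈ vbar.asIdeal) (hne : vbar ≠ v)
    {θsub θquot : FramedGaloisRep K (padicCoeffIntegers (∅ : Set (PadicAlgCl p))) 1}
    (hpair : IsResidualPairOver (W.baseChange K) p θsub θquot) :
    ∃ τ ∈ inertia vbar, unitChar θsub τ ≠ 1 := by
  haveI hEK : (W.baseChange K).IsElliptic := inferInstanceAs (W.map (algebraMap ℚ K)).IsElliptic
  obtain ⟨Φ, hSub, -, ⟨j₁, hj₁, hj₁inj, -⟩, -⟩ :=
    ResidualPairStableLine.exists_stableLine_of_isResidualPairOver (W.baseChange K) hpair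
  obtain ⟨-, hcases⟩ := localData_of_anomalousTwist W K vbar hp3 hV ha C hC hK hpvK hvbar hne Φ hSub
  rcases hcases with ⟨hfixD, -⟩ | ⟨⟨g, hg, x, hx⟩, -⟩
  · exact (false_of_forall_decomp_smul_sub_eq hp3 hV ha C hC hnorm hred hK hpvK hvbar hne Φ hSub hfixD).elim
  · refine ⟨g, hg, fun h1 ↦ hx ?_⟩
    apply hj₁inj
    rw [hj₁]
    exact CharLocalVanishing.smul_eq_self_of_unitChar_eq_one θsub h1 (j₁ x)

/-- **The `D_v̄`-form** consumed by FILES 3–7 (`hram : ∃ τ ∈ decomp vbar, unitChar θsub τ ≠ 1`). [cite: KellerYin2024, arXiv:2402.12781v2 Prop. 1.3.1] -/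
theorem exists_mem_decomp_unitChar_ne_one_of_anomalousTwist_of_normalised (hp3 : p = 3) (hV : GoodOrd V p)
    (ha : (p : ℤ) ∣ V.frobeniusTrace p - 1)
    (C : VariableChange ℚ) (hC : C • V.quadraticTwist ((-1 : ℚ) ^ (p / 2) * p) = W)
    (hnorm : ∀ Ψ : AddSubgroup (geomTorsion W (p : ℤ)), IsRationalLine W p Ψ → ¬ LineDecompositionTrivialAt W p Ψ)
    (hred : Red W p) (hK : IsImaginaryQuadratic K) {v vbar : HeightOneSpectrum (𝓞 K)} (hpvK : ((p : ℕ) : 𝓞 K) ∈ v.asIdeal)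
    (hvbar : ((p : ℕ) : 𝓞 K) ∈ vbar.asIdeal) (hne : vbar ≠ v)
    {θsub θquot : FramedGaloisRep K (padicCoeffIntegers (∅ : Set (PadicAlgCl p))) 1}
    (hpair : IsResidualPairOver (W.baseChange K) p θsub θquot) :
    ∃ τ ∈ decomp vbar, unitChar θsub τ ≠ 1 := by
  obtain ⟨τ, hτ, hne1⟩ := exists_mem_inertia_unitChar_ne_one_of_anomalousTwist_of_normalised hp3 hV ha C hC hnorm hred hK hpvK
    hvbar hne hpair
  exact ⟨τ, GreenbergSelmer.inertia_le_decomp vbar hτ, hne1⟩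

/-! ## §4. `W(K)[3] = 0` under the normalisation -/

/-- **`W(K)[3] = 0`** for the anomalous `(−3)`-twist under the normalisation, `K` imaginary quadratic with `3 = v v̄`: a `K`-rational point `Q`
of order `3` spans a line of `W_K[3]` FIXED pointwise by `Γ_K ⊇ D_v̄` — §3's contradiction.  This discharges the binder
`htor : ∀ Q, 3 • Q = 0 → Q = 0` of FILES 3–7 (Keller–Yin's standing `H⁰(K, ρ̄) = 0`). The door analogue of generation 28's
`GoodLatticeNoKTorsion.forall_baseChange_nsmul_eq_zero_of_forall_not_lineUnramifiedAt` and of x2's `SplitMultLatticeBinders`.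
[cite: KellerYin2024, arXiv:2402.12781v2 §1.4 (TeX L1083, H⁰(K, ρ̄_f) = 0); arXiv:2410.23241 §3.3] -/
theorem forall_baseChange_nsmul_eq_zero_of_anomalousTwist_of_normalised (hp3 : p = 3) (hV : GoodOrd V p)
    (ha : (p : ℤ) ∣ V.frobeniusTrace p - 1)
    (C : VariableChange ℚ) (hC : C • V.quadraticTwist ((-1 : ℚ) ^ (p / 2) * p) = W)
    (hnorm : ∀ Ψ : AddSubgroup (geomTorsion W (p : ℤ)), IsRationalLine W p Ψ → ¬ LineDecompositionTrivialAt W p Ψ)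
    (hred : Red W p) (hK : IsImaginaryQuadratic K) {v vbar : HeightOneSpectrum (𝓞 K)} (hpvK : ((p : ℕ) : 𝓞 K) ∈ v.asIdeal)
    (hvbar : ((p : ℕ) : 𝓞 K) ∈ vbar.asIdeal) (hne : vbar ≠ v) :
    ∀ Q : (W.baseChange K).toAffine.Point, p • Q = 0 → Q = 0 := by
  have hpp : p.Prime := hp.out
  haveI hEK : (W.baseChange K).IsElliptic := inferInstanceAs (W.map (algebraMap ℚ K)).IsElliptic
  intro Q hQ
  by_contra hQ0
  -- the geometric point of `Q`, fixed by `Γ_K`, of order `p`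
  set R : geomPoints (W.baseChange K) := (W.baseChange K).toGeomPoints Q with hR
  have hRfix : ∀ g : absoluteGaloisGroup K, g • R = R := fun g ↦ (W.baseChange K).smul_toGeomPoints g Q
  have hRp : ((p : ℕ) : ℤ) • R = 0 := by
    rw [hR, natCast_zsmul, ← map_nsmul, hQ, map_zero]
  have hR0 : R ≠ 0 := fun h ↦ hQ0 ((W.baseChange K).toGeomPoints_injective (by rw [← hR, h, map_zero]))
  set R' : ↥((W.baseChange K).geomTorsion ((p : ℕ) : ℤ)) := ⟨R, (Submodule.mem_torsionBy_iff _ _).mpr hRp⟩ with hR'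
  have hR'0 : R' ≠ 0 := fun h ↦ hR0 (congrArg Subtype.val h)
  have hR'fix : ∀ g : absoluteGaloisGroup K, g • R' = R' := fun g ↦ Subtype.ext (by
    rw [AddSubgroup.torsionBy.coe_smul]; exact hRfix g)
  -- the `Γ_K`-fixed line `ℤ R'` as a stable subgroup
  let S : StableSubgroup (absoluteGaloisGroup K) ↥((W.baseChange K).geomTorsion ((p : ℕ) : ℤ)) :=
    { toAddSubgroup := AddSubgroup.zmultiples R'
      smul_mem' := fun g P hP ↦ by
        obtain ⟨m, rfl⟩ := AddSubgroup.mem_zmultiples_iff.mp hP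
        rw [smul_comm g m R', hR'fix g]
        exact AddSubgroup.zsmul_mem _ (AddSubgroup.mem_zmultiples R') m }
  have hSub : Nat.card S.Sub = p := by
    change Nat.card (AddSubgroup.zmultiples R') = p
    have hord : addOrderOf R' = p := addOrderOf_eq_prime
      (Subtype.ext (by rw [AddSubmonoidClass.coe_nsmul, ← natCast_zsmul]; exact hRp)) hR'0
    rw [Nat.card_zmultiples, hord]
  have hfixD : ∀ g ∈ decomp vbar, ∀ x : S.Sub, g • x = x := by
    intro g _ x
    apply S.incl_injective
    rw [StableSubgroup.incl_smul]
    have hxS : S.incl x ∈ S.toAddSubgroup := by rw [← S.range_incl]; exact ⟨x, rfl⟩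
    obtain ⟨m, hm⟩ := AddSubgroup.mem_zmultiples_iff.mp hxS
    rw [← hm, smul_comm g m R', hR'fix g]
  exact false_of_forall_decomp_smul_sub_eq hp3 hV ha C hC hnorm hred hK hpvK hvbar hne S hSub hfixD

end Quadratic

end Summit.BirchSwinnertonDyer.BirchSwinnertonDyer.Theorems.SchneiderFreeAdditiveX3.AnomalousTwistOrientation

end
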